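import Mathlib
import Summits.AtomisticToContinuum.FouriersLaw.Theorems.EmbeddedDrudeMourreGreenKuboContinuationAbelFloorOfEinsteinHelfand
import HarnessLib

/-!
# Toolkit for stub `stub_abelExchange` of line `regularity_collapse`, crux `HoelderEscapeProfile.AbelSpreadCeiling`
(item stmt-AtomisticToContinuum-16010; `--supports` file, closes nothing; PURE REAL ANALYSIS, Mathlib only; consumed by
`Theorems/HoelderEscapeProfileAbelSpreadCeilingAbelExchange.lean`, which proves the registered stub)

WHAT. The three model-free ingredients of the dynamics-free Abel exchange lemma (stub 6 of the skeleton
`Cruxes/AbelSpreadCeiling/Lines/regularity_collapse.lean`):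
§1 CUT-OFF WEIGHTS `c_L(x) = x² − 2q_L(x) + 2q_{3L}(x) − q_{4L}(x)` with the symmetric quadratic ramps
`q_a(x) = ((x−a)₊)² + ((−x−a)₊)²` (`exists_cutoff`, stated as an existence result so that no `def` is introduced):
`c_L = x²` on `|x| ≤ L`, `|c_L| ≤ 11x²`, discrete Laplacian `|Δc_L| ≤ 10` uniformly in `L` and `Δc_L = 2` on
`|x| + 1 ≤ L`, and `c_L, c_L(·±1)` vanish off the window `[−(4L+2), 4L+2]`.
§2 LAPLACE TRANSFORM OF THE DOUBLE PRIMITIVE (`stub_abelExchangeLaplace`, registered as a sub-stub of the crux so that this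
toolkit can land as a `--supports` file): for continuous `g` with `|g| ≤ B` on
`(0,∞)` and `e^{−νu}B(u) ∈ L¹(0,∞)`, `t ↦ e^{−νt}∫_{(0,t]}(t−u)g(u)du ∈ L¹(0,∞)` and
`∫₀^∞ e^{−νt}(∫_{(0,t]}(t−u)g(u)du)dt = ν^{-2}∫₀^∞ e^{−νu}g(u)du` — Fubini–Tonelli on `(0,∞)²` with the continuous
joint integrand `e^{−νt}(t−u)₊g(u)` and the landed kernel integral `∫_{t>0}e^{−νt}(t−u)₊dt = e^{−νu}/ν²`
(`GreenKuboContinuation.SpectralTrichotomy.abelFloor_integral_exp_neg_mul_ramp`).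
§3 SUMMATION BY PARTS for finitely supported weights (`sum_mul_laplacian_eq`) and DOMINATED CONVERGENCE IN `x`
(`tendsto_tsum_cutoff_mul`, Tannery: `Σ_x c_L(x)a(x) → Σ_x x²a(x)` when `Σ_x(1+x²)|a(x)| < ∞`).
-/

noncomputable section

namespace Summit.AtomisticToContinuum.FouriersLaw.Theorems.AbelSpreadCeiling.RegularityCollapse

open MeasureTheory Filter Set Function
open scoped Topology BigOperators

namespace AbelExchange

/-! ### §1 The cut-off weights (one-sided ramps `((x − a)₊)²`, integer knee `a`, integer site `x`) -/

/-- Below the knee the ramp vanishes. [folklore] -/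
theorem ramp_of_le {a : ℕ} {x : ℤ} (h : x ≤ (a : ℤ)) : (max ((x : ℝ) - a) 0) ^ 2 = 0 := by
  have h' : (x : ℝ) - a ≤ 0 := by
    have : (x : ℝ) ≤ ((a : ℤ) : ℝ) := (Int.cast_le (R := ℝ)).2 h
    push_cast at this
    linarith
  simp [max_eq_right h']

/-- Above the knee the ramp is the square. [folklore] -/
theorem ramp_of_ge {a : ℕ} {x : ℤ} (h : (a : ℤ) ≤ x) : (max ((x : ℝ) - a) 0) ^ 2 = ((x : ℝ) - a) ^ 2 := by
  have h' : 0 ≤ (x : ℝ) - a := by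
    have : ((a : ℤ) : ℝ) ≤ (x : ℝ) := (Int.cast_le (R := ℝ)).2 h
    push_cast at this
    linarith
  simp [max_eq_left h']

/-- The ramp is at most `x²`. [folklore] -/
theorem ramp_le_sq (a : ℕ) (x : ℤ) : (max ((x : ℝ) - a) 0) ^ 2 ≤ (x : ℝ) ^ 2 := by
  rcases le_or_gt x a with h | h
  · rw [ramp_of_le h]; positivity
  · rw [ramp_of_ge h.le]
    have h1 : (0:ℝ) ≤ a := by positivity
    have h2 : ((a : ℤ) : ℝ) ≤ x := by exact_mod_cast h.le
    push_cast at h2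
    nlinarith

/-- The discrete Laplacian of the ramp takes values in `[0, 2]`. [folklore] -/
theorem laplacian_ramp_mem (a : ℕ) (x : ℤ) :
    (max (((x + 1 : ℤ) : ℝ) - a) 0) ^ 2 - 2 * (max ((x : ℝ) - a) 0) ^ 2
      + (max (((x - 1 : ℤ) : ℝ) - a) 0) ^ 2 ∈ Set.Icc (0:ℝ) 2 := by
  rcases lt_trichotomy x a with h | h | h
  · rw [ramp_of_le (show x + 1 ≤ (a : ℤ) by omega), ramp_of_le h.le,
      ramp_of_le (show x - 1 ≤ (a : ℤ) by omega)]
    norm_num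
  · subst h
    rw [ramp_of_ge (show (a : ℤ) ≤ a + 1 by omega), ramp_of_le le_rfl,
      ramp_of_le (show (a : ℤ) - 1 ≤ a by omega)]
    push_cast
    norm_num
  · rw [ramp_of_ge (show (a : ℤ) ≤ x + 1 by omega), ramp_of_ge h.le,
      ramp_of_ge (show (a : ℤ) ≤ x - 1 by omega)]
    push_cast
    constructor <;> nlinarith

/-- The discrete Laplacian of the symmetric ramp `((x−a)₊)² + ((−x−a)₊)²` takes values in `[0, 4]`. [folklore] -/
theorem laplacian_sramp_mem (a : ℕ) (x : ℤ) :
    ((max (((x + 1 : ℤ) : ℝ) - a) 0) ^ 2 + (max (((-(x + 1) : ℤ) : ℝ) - a) 0) ^ 2)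
      - 2 * ((max ((x : ℝ) - a) 0) ^ 2 + (max (((-x : ℤ) : ℝ) - a) 0) ^ 2)
      + ((max (((x - 1 : ℤ) : ℝ) - a) 0) ^ 2 + (max (((-(x - 1) : ℤ) : ℝ) - a) 0) ^ 2)
      ∈ Set.Icc (0:ℝ) 4 := by
  have h1 := laplacian_ramp_mem a x
  have h2 := laplacian_ramp_mem a (-x)
  simp only [Set.mem_Icc] at *
  have e1 : -(x + 1) = -x - 1 := by ring
  have e2 : -(x - 1) = -x + 1 := by ring
  rw [e1, e2]
  constructor <;> linarith [h1.1, h1.2, h2.1, h2.2]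

/-- The symmetric ramp lies in `[0, 2x²]`. [folklore] -/
theorem sramp_mem (a : ℕ) (x : ℤ) :
    (max ((x : ℝ) - a) 0) ^ 2 + (max (((-x : ℤ) : ℝ) - a) 0) ^ 2 ∈ Set.Icc (0:ℝ) (2 * (x : ℝ) ^ 2) := by
  have h1 := ramp_le_sq a x
  have h2 := ramp_le_sq a (-x)
  have e : (((-x : ℤ) : ℝ)) ^ 2 = (x : ℝ) ^ 2 := by push_cast; ring
  rw [e] at h2
  simp only [Set.mem_Icc]
  constructor
  · positivity
  · linarith

/-- **The cut-off weights.** There is a family `c_L : ℤ → ℝ` (`L : ℕ`) with `c_L(x) = x²` for `|x| ≤ L`,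
`|c_L(x)| ≤ 11x²`, discrete Laplacian bounded by `10` and equal to `2` for `|x| + 1 ≤ L`, and `c_L`, `c_L(· ± 1)`
supported in the window `[−(4L+2), 4L+2]`; namely `c_L = x² − 2q_L + 2q_{3L} − q_{4L}` with the symmetric ramps
`q_a(x) = ((x−a)₊)² + ((−x−a)₊)²`. [folklore] -/
theorem exists_cutoff : ∃ c : ℕ → ℤ → ℝ,
    (∀ (L : ℕ) (x : ℤ), x ≤ (L : ℤ) → -x ≤ (L : ℤ) → c L x = (x : ℝ) ^ 2) ∧
    (∀ (L : ℕ) (x : ℤ), |c L x| ≤ 11 * (x : ℝ) ^ 2) ∧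
    (∀ (L : ℕ) (x : ℤ), |c L (x + 1) - 2 * c L x + c L (x - 1)| ≤ 10) ∧
    (∀ (L : ℕ) (x : ℤ), x + 1 ≤ (L : ℤ) → -x + 1 ≤ (L : ℤ) → c L (x + 1) - 2 * c L x + c L (x - 1) = 2) ∧
    (∀ (L : ℕ) (x : ℤ), x ∉ Finset.Icc (-((4 * L + 2 : ℕ) : ℤ)) ((4 * L + 2 : ℕ) : ℤ) →
      c L x = 0 ∧ c L (x + 1) = 0 ∧ c L (x - 1) = 0) := by
  -- the symmetric ramp and the weight, as local functions
  set q : ℕ → ℤ → ℝ := fun a x => (max ((x : ℝ) - a) 0) ^ 2 + (max (((-x : ℤ) : ℝ) - a) 0) ^ 2 with hq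
  set c : ℕ → ℤ → ℝ := fun L x => (x : ℝ) ^ 2 - 2 * q L x + 2 * q (3 * L) x - q (4 * L) x with hc
  -- values of the symmetric ramp in the three regimes
  have q_mid : ∀ (a : ℕ) (x : ℤ), x ≤ (a : ℤ) → -x ≤ (a : ℤ) → q a x = 0 := fun a x h1 h2 => by
    simp only [hq]; rw [ramp_of_le h1, ramp_of_le h2, add_zero]
  have q_right : ∀ (a : ℕ) (x : ℤ), (a : ℤ) ≤ x → q a x = ((x : ℝ) - a) ^ 2 := fun a x h => by
    simp only [hq]; rw [ramp_of_ge h, ramp_of_le (show -x ≤ (a : ℤ) by omega), add_zero]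
  have q_left : ∀ (a : ℕ) (x : ℤ), x ≤ -(a : ℤ) → q a x = (((-x : ℤ) : ℝ) - a) ^ 2 := fun a x h => by
    simp only [hq]; rw [ramp_of_le (show x ≤ (a : ℤ) by omega), ramp_of_ge (show (a : ℤ) ≤ -x by omega), zero_add]
  have c_sq : ∀ (L : ℕ) (x : ℤ), x ≤ (L : ℤ) → -x ≤ (L : ℤ) → c L x = (x : ℝ) ^ 2 := fun L x h1 h2 => by
    simp only [hc]
    rw [q_mid L x h1 h2, q_mid (3 * L) x (by omega) (by omega), q_mid (4 * L) x (by omega) (by omega)]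
    ring
  have c_zero_right : ∀ (L : ℕ) (x : ℤ), ((4 * L : ℕ) : ℤ) ≤ x → c L x = 0 := fun L x h => by
    simp only [hc]
    rw [q_right L x (by omega), q_right (3 * L) x (by omega), q_right (4 * L) x h]
    push_cast
    ring
  have c_zero_left : ∀ (L : ℕ) (x : ℤ), x ≤ -((4 * L : ℕ) : ℤ) → c L x = 0 := fun L x h => by
    simp only [hc]
    rw [q_left L x (by omega), q_left (3 * L) x (by omega), q_left (4 * L) x h]
    push_cast
    ring
  refine ⟨c, c_sq, fun L x => ?_, fun L x => ?_, fun L x h1 h2 => ?_, fun L x h => ?_⟩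
  · -- `|c_L(x)| ≤ 11x²`
    have h1 := sramp_mem L x
    have h2 := sramp_mem (3 * L) x
    have h3 := sramp_mem (4 * L) x
    simp only [Set.mem_Icc] at h1 h2 h3
    rw [abs_le]
    simp only [hc, hq]
    constructor <;> nlinarith [h1.1, h1.2, h2.1, h2.2, h3.1, h3.2, sq_nonneg (x : ℝ)]
  · -- `|Δc_L(x)| ≤ 10`
    have h1 := laplacian_sramp_mem L x
    have h2 := laplacian_sramp_mem (3 * L) x
    have h3 := laplacian_sramp_mem (4 * L) x
    simp only [Set.mem_Icc] at h1 h2 h3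
    have e2 : ((x + 1 : ℤ) : ℝ) ^ 2 - 2 * (x : ℝ) ^ 2 + ((x - 1 : ℤ) : ℝ) ^ 2 = 2 := by push_cast; ring
    rw [abs_le]
    simp only [hc, hq]
    constructor <;> linarith [h1.1, h1.2, h2.1, h2.2, h3.1, h3.2]
  · -- `Δc_L(x) = 2` well inside
    rw [c_sq L (x + 1) h1 (by omega), c_sq L x (by omega) (by omega), c_sq L (x - 1) (by omega) (by omega)]
    push_cast
    ring
  · -- support
    simp only [Finset.mem_Icc, not_and_or, not_le] at h
    rcases h with h | h
    · exact ⟨c_zero_left L x (by omega), c_zero_left L (x + 1) (by omega), c_zero_left L (x - 1) (by omega)⟩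
    · exact ⟨c_zero_right L x (by omega), c_zero_right L (x + 1) (by omega),
        c_zero_right L (x - 1) (by omega)⟩

/-! ### §2 Laplace transform of the double primitive

The two Laplace integrals `∫₀^∞ e^{−νt}dt = 1/ν` and `∫_{t>0} e^{−νt}(t−u)₊dt = e^{−νu}/ν²` (`u ≥ 0`) are the landed
`GreenKuboContinuation.SpectralTrichotomy.abelFloor_integral_exp_neg_mul_Ioi` /
`abelFloor_integral_exp_neg_mul_ramp` (`Theorems/EmbeddedDrudeMourreGreenKuboContinuationAbelFloorOfEinsteinHelfand.lean`),
reused here; what is new is the Fubini step WITHOUT a uniform bound on `g` (only Laplace domination). -/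

/-- The kernel `t ↦ e^{−νt}(t−u)₊` is integrable on `(0, ∞)` (its integral is not zero). [folklore] -/
theorem integrableOn_exp_neg_mul_posPart {ν : ℝ} (hν : 0 < ν) {u : ℝ} (hu : 0 ≤ u) :
    IntegrableOn (fun t : ℝ => Real.exp (-(ν * t)) * max (t - u) 0) (Ioi 0) :=
  Integrable.of_integral_ne_zero
    (by rw [GreenKuboContinuation.SpectralTrichotomy.abelFloor_integral_exp_neg_mul_ramp hν hu]; positivity)

/-- **Laplace transform of the double primitive** (sub-stub `stub_abelExchangeLaplace`, registered signature
verbatim). For `g` continuous with `|g| ≤ B` on `(0,∞)` and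
`e^{−νu}B(u)` integrable on `(0,∞)` (`ν > 0`): `t ↦ e^{−νt}∫_{(0,t]}(t−u)g(u)du` is integrable on `(0,∞)` and
`∫₀^∞ e^{−νt}(∫_{(0,t]}(t−u)g(u)du)dt = ν^{-2}∫₀^∞ e^{−νu}g(u)du` — Fubini–Tonelli on `(0,∞)²` for the continuous
joint integrand `e^{−νt}(t−u)₊g(u)`, whose `t`-integral is `e^{−νu}g(u)/ν²` by the kernel integral. [folklore] -/
theorem stub_abelExchangeLaplace :
    ∀ (ν : ℝ), 0 < ν → ∀ (g B : ℝ → ℝ), Continuous g → (∀ u : ℝ, 0 < u → |g u| ≤ B u) → MeasureTheory.IntegrableOn (fun u : ℝ => Real.exp (-(ν * u)) * B u) (Set.Ioi 0) → MeasureTheory.IntegrableOn (fun t : ℝ => Real.exp (-(ν * t)) * ∫ u in Set.Ioc (0:ℝ) t, (t - u) * g u) (Set.Ioi 0) ∧ ∫ t in Set.Ioi (0:ℝ), Real.exp (-(ν * t)) * ∫ u in Set.Ioc (0:ℝ) t, (t - u) * g u = 1 / ν ^ 2 * ∫ u in Set.Ioi (0:ℝ), Real.exp (-(ν * u)) * g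 u := by
  intro ν hν g B hg hgB hB
  -- the joint integrand on `(0,∞)²`
  set H : ℝ → ℝ → ℝ := fun t u => Real.exp (-(ν * t)) * max (t - u) 0 * g u with hH
  have hHc : Continuous (uncurry H) := by
    show Continuous fun p : ℝ × ℝ => Real.exp (-(ν * p.1)) * max (p.1 - p.2) 0 * g p.2
    fun_prop
  -- inner integral in `u`
  have inner_u : ∀ t : ℝ, 0 < t →
      ∫ u in Ioi (0:ℝ), H t u = Real.exp (-(ν * t)) * ∫ u in Ioc (0:ℝ) t, (t - u) * g u := by
    intro t _
    have e1 : (fun u => H t u) =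
        fun u => Real.exp (-(ν * t)) * (Iic t).indicator (fun u => (t - u) * g u) u := by
      funext u
      show Real.exp (-(ν * t)) * max (t - u) 0 * g u = _
      by_cases h : u ≤ t
      · rw [Set.indicator_of_mem (show u ∈ Iic t from h), max_eq_left (sub_nonneg.2 h)]
        ring
      · rw [Set.indicator_of_notMem (show u ∉ Iic t from h), max_eq_right (sub_nonpos.2 (not_le.1 h).le)]
        ring
    rw [e1, integral_const_mul, setIntegral_indicator measurableSet_Iic, Ioi_inter_Iic]
  -- inner integral in `t`, and of the norm
  have inner_t : ∀ u : ℝ, 0 < u → ∫ t in Ioi (0:ℝ), H t u = Real.exp (-(ν * u)) / ν ^ 2 * g u := by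
    intro u hu
    show ∫ t in Ioi (0:ℝ), Real.exp (-(ν * t)) * max (t - u) 0 * g u = _
    rw [integral_mul_const, GreenKuboContinuation.SpectralTrichotomy.abelFloor_integral_exp_neg_mul_ramp hν hu.le]
  have inner_t_norm : ∀ u : ℝ, 0 < u →
      ∫ t in Ioi (0:ℝ), ‖H t u‖ = Real.exp (-(ν * u)) / ν ^ 2 * |g u| := by
    intro u hu
    have e1 : (fun t => ‖H t u‖) = fun t => Real.exp (-(ν * t)) * max (t - u) 0 * |g u| := by
      funext t
      show ‖Real.exp (-(ν * t)) * max (t - u) 0 * g u‖ = _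
      rw [Real.norm_eq_abs, abs_mul, abs_mul, Real.abs_exp, abs_of_nonneg (le_max_right (t - u) 0)]
    rw [e1, integral_mul_const, GreenKuboContinuation.SpectralTrichotomy.abelFloor_integral_exp_neg_mul_ramp hν hu.le]
  -- integrability on the product of the restricted Lebesgue measures (Tonelli in the order `dt du`)
  have hint : Integrable (uncurry H)
      ((volume.restrict (Ioi (0:ℝ))).prod (volume.restrict (Ioi (0:ℝ)))) := by
    rw [integrable_prod_iff' hHc.aestronglyMeasurable]
    refine ⟨?_, ?_⟩
    · rw [ae_restrict_iff' measurableSet_Ioi]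
      refine Eventually.of_forall fun u hu => ?_
      show Integrable (fun t => Real.exp (-(ν * t)) * max (t - u) 0 * g u) (volume.restrict (Ioi 0))
      exact (integrableOn_exp_neg_mul_posPart hν (le_of_lt hu)).mul_const _
    · have e2 : (fun u => ∫ t, ‖uncurry H (t, u)‖ ∂(volume.restrict (Ioi (0:ℝ)))) =ᵐ[volume.restrict (Ioi (0:ℝ))]
          fun u => 1 / ν ^ 2 * (Real.exp (-(ν * u)) * |g u|) := by
        rw [EventuallyEq, ae_restrict_iff' measurableSet_Ioi]
        refine Eventually.of_forall fun u hu => ?_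
        simp only [uncurry_apply_pair]
        rw [inner_t_norm u hu]
        ring
      rw [integrable_congr e2]
      refine Integrable.const_mul ?_ _
      refine Integrable.mono' hB ?_ ?_
      · exact (by fun_prop : Continuous fun u => Real.exp (-(ν * u)) * |g u|).aestronglyMeasurable
      · rw [ae_restrict_iff' measurableSet_Ioi]
        refine Eventually.of_forall fun u hu => ?_
        rw [Real.norm_eq_abs, abs_mul, abs_abs, Real.abs_exp]
        exact mul_le_mul_of_nonneg_left (hgB u hu) (Real.exp_pos _).le
  -- Fubini
  have hswap := integral_integral_swap hint
  have lhs : ∫ t in Ioi (0:ℝ), ∫ u in Ioi (0:ℝ), H t u =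
      ∫ t in Ioi (0:ℝ), Real.exp (-(ν * t)) * ∫ u in Ioc (0:ℝ) t, (t - u) * g u :=
    setIntegral_congr_fun measurableSet_Ioi fun t ht => inner_u t ht
  have rhs : ∫ u in Ioi (0:ℝ), ∫ t in Ioi (0:ℝ), H t u =
      1 / ν ^ 2 * ∫ u in Ioi (0:ℝ), Real.exp (-(ν * u)) * g u := by
    rw [← integral_const_mul]
    exact setIntegral_congr_fun measurableSet_Ioi fun u hu => by rw [inner_t u hu]; ring
  refine ⟨?_, by rw [← lhs, hswap, rhs]⟩
  refine hint.integral_prod_left.congr ?_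
  rw [EventuallyEq, ae_restrict_iff' measurableSet_Ioi]
  exact Eventually.of_forall fun t ht => by simpa only [uncurry_apply_pair] using inner_u t ht

/-! ### §3 Summation by parts and dominated convergence in `x` -/

/-- **Summation by parts** for a weight vanishing, together with its two shifts, off a finite window `F`:
`Σ_{x∈F} c(x)(γ(x+1) − 2γ(x) + γ(x−1)) = Σ_{x∈F} (c(x+1) − 2c(x) + c(x−1)) γ(x)`. [folklore] -/
theorem sum_mul_laplacian_eq {F : Finset ℤ} {c : ℤ → ℝ}
    (hc : ∀ x ∉ F, c x = 0 ∧ c (x + 1) = 0 ∧ c (x - 1) = 0) (γ : ℤ → ℝ) :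
    ∑ x ∈ F, c x * (γ (x + 1) - 2 * γ x + γ (x - 1)) =
      ∑ x ∈ F, (c (x + 1) - 2 * c x + c (x - 1)) * γ x := by
  have s1 : Summable fun x => c x * γ (x + 1) :=
    summable_of_ne_finset_zero (s := F) fun x hx => by rw [(hc x hx).1, zero_mul]
  have s2 : Summable fun x => c x * γ x :=
    summable_of_ne_finset_zero (s := F) fun x hx => by rw [(hc x hx).1, zero_mul]
  have s3 : Summable fun x => c x * γ (x - 1) :=
    summable_of_ne_finset_zero (s := F) fun x hx => by rw [(hc x hx).1, zero_mul]
  have s1' : Summable fun x => c (x - 1) * γ x :=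
    summable_of_ne_finset_zero (s := F) fun x hx => by rw [(hc x hx).2.2, zero_mul]
  have s3' : Summable fun x => c (x + 1) * γ x :=
    summable_of_ne_finset_zero (s := F) fun x hx => by rw [(hc x hx).2.1, zero_mul]
  have e1 : ∑' x, c x * γ (x + 1) = ∑' x, c (x - 1) * γ x := by
    rw [← Equiv.tsum_eq (Equiv.addRight (1:ℤ)) (fun y => c (y - 1) * γ y)]
    exact tsum_congr fun x => by simp
  have e3 : ∑' x, c x * γ (x - 1) = ∑' x, c (x + 1) * γ x := by
    rw [← Equiv.tsum_eq (Equiv.subRight (1:ℤ)) (fun y => c (y + 1) * γ y)]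
    exact tsum_congr fun x => by simp
  have t1 : ∑ x ∈ F, c x * (γ (x + 1) - 2 * γ x + γ (x - 1)) = ∑' x, c x * (γ (x + 1) - 2 * γ x + γ (x - 1)) :=
    (tsum_eq_sum fun x hx => by rw [(hc x hx).1, zero_mul]).symm
  have t2 : ∑ x ∈ F, (c (x + 1) - 2 * c x + c (x - 1)) * γ x = ∑' x, (c (x + 1) - 2 * c x + c (x - 1)) * γ x :=
    (tsum_eq_sum fun x hx => by rw [(hc x hx).1, (hc x hx).2.1, (hc x hx).2.2]; ring).symm
  rw [t1, t2]
  calc ∑' x, c x * (γ (x + 1) - 2 * γ x + γ (x - 1))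
      = ∑' x, (c x * γ (x + 1) - 2 * (c x * γ x) + c x * γ (x - 1)) := tsum_congr fun x => by ring
    _ = ∑' x, c x * γ (x + 1) - 2 * ∑' x, c x * γ x + ∑' x, c x * γ (x - 1) := by
        rw [(s1.sub (s2.mul_left 2)).tsum_add s3, s1.tsum_sub (s2.mul_left 2), tsum_mul_left]
    _ = ∑' x, c (x - 1) * γ x - 2 * ∑' x, c x * γ x + ∑' x, c (x + 1) * γ x := by rw [e1, e3]
    _ = ∑' x, (c (x - 1) * γ x - 2 * (c x * γ x) + c (x + 1) * γ x) := by
        rw [(s1'.sub (s2.mul_left 2)).tsum_add s3', s1'.tsum_sub (s2.mul_left 2), tsum_mul_left]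
    _ = ∑' x, (c (x + 1) - 2 * c x + c (x - 1)) * γ x := tsum_congr fun x => by ring

/-- **Dominated convergence in `x` (Tannery).** For cut-off weights with `c_L(x) = x²` on `|x| ≤ L` and
`|c_L| ≤ 11x²`: `Σ_x c_L(x) a(x) → Σ_x x² a(x)` as `L → ∞` whenever `Σ_x (1+x²)|a(x)| < ∞`. [folklore] -/
theorem tendsto_tsum_cutoff_mul (c : ℕ → ℤ → ℝ)
    (hc_sq : ∀ (L : ℕ) (x : ℤ), x ≤ (L : ℤ) → -x ≤ (L : ℤ) → c L x = (x : ℝ) ^ 2)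
    (hc_abs : ∀ (L : ℕ) (x : ℤ), |c L x| ≤ 11 * (x : ℝ) ^ 2)
    {a : ℤ → ℝ} (ha : Summable fun x : ℤ => (1 + (x : ℝ) ^ 2) * |a x|) :
    Tendsto (fun L : ℕ => ∑' x : ℤ, c L x * a x) atTop (𝓝 (∑' x : ℤ, (x : ℝ) ^ 2 * a x)) := by
  refine tendsto_tsum_of_dominated_convergence (f := fun (L : ℕ) (x : ℤ) => c L x * a x)
    (bound := fun x => 11 * ((1 + (x : ℝ) ^ 2) * |a x|)) (ha.mul_left 11) (fun x => ?_)
    (Eventually.of_forall fun L x => ?_)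
  · refine tendsto_nhds_of_eventually_eq ?_
    filter_upwards [eventually_ge_atTop x.natAbs] with L hL
    simp only [hc_sq L x (by omega) (by omega)]
  · rw [Real.norm_eq_abs, abs_mul]
    have h1 := hc_abs L x
    have h3 := abs_nonneg (a x)
    calc |c L x| * |a x| ≤ 11 * (x : ℝ) ^ 2 * |a x| := mul_le_mul_of_nonneg_right h1 h3
      _ ≤ 11 * ((1 + (x : ℝ) ^ 2) * |a x|) := by nlinarith

end AbelExchange

end Summit.AtomisticToContinuum.FouriersLaw.Theorems.AbelSpreadCeiling.RegularityCollapse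

end
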